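import Literature.NumberTheory.GaloisRepresentations.AbstractReciprocityMap
import HarnessLib

/-!
# Conjugation-equivariance of Neukirch's abstract reciprocity map (theorems only)

Topic `NumberTheory/GaloisRepresentations` (abstract class field theory, Neukirch, *Algebraic
Number Theory*, Ch. IV §§4–6); namespace
`Literature.NumberTheory.GaloisRepresentations.AbstractCFT.WeilDatum`.  No definitions, no named
facts.

For a Weil datum `d` on `(W, A)` satisfying the class field axiom, fields `V ≤ U` of `d` with `U`
normalising `V` (`L|K` Galois), `τ ∈ U` and ANY `ρ ∈ W`, the reciprocity map is compatible with
conjugation by `ρ` ("transport of structure", the functoriality of the norm residue symbol under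
`σ : L|K → σL|σK`, Neukirch IV (5.8)/(6.4) — everything in the datum is canonical up to the
choices of a Frobenius lift and of a prime element, and both choices are irrelevant by (5.5),
(5.6)):

* `IsClassFieldTheory.recMap_conjSub` —
  `r_{ρL|ρK}(ρ τ ρ⁻¹) = ρ · r_{L|K}(τ)` in `A / N_{ρL|ρK} A_{ρL}`, i.e.
  `d.recMap (conjSub ρ U) (conjSub ρ V) (ρ * τ * ρ⁻¹)` is the image of `d.recMap U V τ` under the
  map of quotients induced by `a ↦ ρ • a` (`smul_normGroup_le`: `ρ • N_{L|K} A_L = N_{ρL|ρK} A_{ρL}`).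

Ingredients from the tree: independence of the Frobenius lift (`IsClassFieldTheory.recMap_eq`)
and of the prime (`IsClassFieldTheory.norm_frobField_div_mem`), `norm_conj`, `val_conjSub`,
`smul_mem_fixedBy_conj`.  Used by the abc-iut cell (layer L4) for the `G_K`-equivariance of the
local reciprocity maps of the finite subextensions `E ⊆ K̄` ([AbsAnab] Prop 1.2.1 input
`mlf_reciprocity_equivariant`).
-/

noncomputable section

open scoped Pointwise

namespace Literature.NumberTheory.GaloisRepresentations

namespace AbstractCFT

variable {W : Type*} [Group W] {A : Type*} [CommGroup A] [MulDistribMulAction W A]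

/-- Conjugation transports normalisers: if `U` normalises `V` then `ρUρ⁻¹` normalises `ρVρ⁻¹`.
[folklore] -/
private theorem conjSub_le_normalizer_conjSub {U V : Subgroup W} (hUn : U ≤ Subgroup.normalizer (V : Set W))
    (ρ : W) : conjSub ρ U ≤ Subgroup.normalizer ((conjSub ρ V : Subgroup W) : Set W) := by
  intro u hu
  rw [mem_conjSub_iff] at hu
  have h := hUn hu
  rw [Subgroup.mem_normalizer_iff] at h ⊢
  intro x
  rw [mem_conjSub_iff, mem_conjSub_iff]
  have hx := h (ρ⁻¹ * x * ρ)
  have e : ρ⁻¹ * u * ρ * (ρ⁻¹ * x * ρ) * (ρ⁻¹ * u * ρ)⁻¹ = ρ⁻¹ * (u * x * u⁻¹) * ρ := by group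
  rw [e] at hx
  exact hx

/-- `ρ • N_{L|K} A_L ⊆ N_{ρL|ρK} A_{ρL}` (norms are conjugation-equivariant, `norm_conj`).
[cite: NeukirchANT1999, Ch. IV §4, Prop. (4.7) (i)] -/
theorem smul_normGroup_le {U V : Subgroup W} [V.FiniteIndex] (ρ : W) :
    normGroup V U ≤ (normGroup (conjSub ρ V) (conjSub ρ U)).comap
      (MulDistribMulAction.toMonoidHom A ρ) := by
  haveI : Finite (U ⧸ V.subgroupOf U) := Subgroup.finite_quotient_of_finiteIndex
  unfold normGroup
  rw [Subgroup.closure_le]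
  rintro _ ⟨a, ha, rfl⟩
  rw [SetLike.mem_coe, Subgroup.mem_comap, MulDistribMulAction.toMonoidHom_apply,
    ← norm_conj ha ρ]
  exact norm_mem_normGroup (smul_mem_fixedBy_conj ha ρ)

namespace WeilDatum

variable (d : WeilDatum W A)

/-- Conjugating a Frobenius field by an arbitrary `ρ ∈ W`:
`ρ · Frob-field(L̃|K; σ) · ρ⁻¹ = Frob-field(ρL̃|ρK; ρσρ⁻¹)` (the inertia group is normal).
[cite: NeukirchANT1999, Ch. IV §5, proof of (5.5)] -/
theorem conjSub_frobField_eq (V : Subgroup W) (σ ρ : W) :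
    conjSub ρ (d.frobField V σ) = d.frobField (conjSub ρ V) (ρ * σ * ρ⁻¹) := by
  have hI : conjSub ρ d.inertia = d.inertia := by
    ext x
    rw [mem_conjSub_iff, mem_inertia_iff, mem_inertia_iff]
    have : ρ⁻¹ * x * ρ = ρ⁻¹ * x * ρ⁻¹⁻¹ := by rw [inv_inv]
    rw [this, degZ_conj]
  unfold frobField
  rw [conjSub, Subgroup.map_sup, ← conjSub, ← conjSub, conjSub_inf, hI, conjSub,
    MonoidHom.map_zpowers]
  rfl

variable {d} in
/-- **Conjugation-equivariance of the reciprocity map** (transport of structure; Neukirch IV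
(5.6) with the functoriality square of (5.8)): for a class field theory `d`, fields `V ≤ U` with
`U` normalising `V`, `τ ∈ U` and any `ρ ∈ W`,
`r_{ρL|ρK}(ρτρ⁻¹) = ρ · r_{L|K}(τ)` — precisely, `d.recMap (ρUρ⁻¹) (ρVρ⁻¹) (ρτρ⁻¹)` is the image
of `d.recMap U V τ` under the homomorphism `A/N_{L|K}A_L → A/N_{ρL|ρK}A_{ρL}` induced by `a ↦ ρ·a`.
[cite: NeukirchANT1999, Ch. IV §5, Prop. (5.6) and (5.8)] -/
theorem IsClassFieldTheory.recMap_conjSub (hcf : d.IsClassFieldTheory) {U V : Subgroup W}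
    (hU : d.IsField U) (hV : d.IsField V) (hVU : V ≤ U)
    (hUn : U ≤ Subgroup.normalizer (V : Set W)) {τ : W} (hτ : τ ∈ U) (ρ : W) :
    haveI := d.finiteIndex hV
    d.recMap (conjSub ρ U) (conjSub ρ V) (ρ * τ * ρ⁻¹) =
      QuotientGroup.map (normGroup V U) (normGroup (conjSub ρ V) (conjSub ρ U))
        (MulDistribMulAction.toMonoidHom A ρ) (smul_normGroup_le ρ) (d.recMap U V τ) := by
  haveI := d.finiteIndex hV
  -- the conjugated data
  have hU' : d.IsField (conjSub ρ U) := d.isField_conjSub hU ρ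
  have hV' : d.IsField (conjSub ρ V) := d.isField_conjSub hV ρ
  have hV'U' : conjSub ρ V ≤ conjSub ρ U := conjSub_mono hVU
  have hU'n : conjSub ρ U ≤ Subgroup.normalizer ((conjSub ρ V : Subgroup W) : Set W) :=
    conjSub_le_normalizer_conjSub hUn ρ
  -- the Frobenius lift `σ` of `τ` and its conjugate
  set σ := d.frobLift U V τ with hσdef
  have hσU : σ ∈ U := d.frobLift_mem hU hτ
  have hdσ : 0 < d.degZ σ := d.degZ_frobLift_pos hU hV τ
  have hτσ : τ⁻¹ * σ ∈ V := d.inv_mul_frobLift_mem hU hV hVU hUn τ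
  have hσ' : ρ * σ * ρ⁻¹ ∈ conjSub ρ U := conj_mem_conjSub_iff.2 hσU
  have hdσ' : 0 < d.degZ (ρ * σ * ρ⁻¹) := by rw [degZ_conj]; exact hdσ
  have hτ' : ρ * τ * ρ⁻¹ ∈ conjSub ρ U := conj_mem_conjSub_iff.2 hτ
  have hτ'σ' : (ρ * τ * ρ⁻¹)⁻¹ * (ρ * σ * ρ⁻¹) ∈ conjSub ρ V := by
    have : (ρ * τ * ρ⁻¹)⁻¹ * (ρ * σ * ρ⁻¹) = ρ * (τ⁻¹ * σ) * ρ⁻¹ := by group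
    rw [this]
    exact conj_mem_conjSub_iff.2 hτσ
  -- independence of the lift: evaluate the left side on the conjugated lift
  rw [hcf.recMap_eq hU' hV' hV'U' hU'n hτ' hσ' hdσ' hτ'σ']
  change _ = QuotientGroup.map _ _ _ _ (QuotientGroup.mk (d.recElt U V σ))
  rw [QuotientGroup.map_mk, MulDistribMulAction.toMonoidHom_apply]
  -- the Frobenius field of the conjugated lift is the conjugate Frobenius field
  set S := d.frobField V σ with hSdef
  have hS : d.IsField S := d.isField_frobField hV (hUn hσU) hdσ
  haveI := d.finiteIndex hS
  haveI : Finite (U ⧸ S.subgroupOf U) := Subgroup.finite_quotient_of_finiteIndex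
  have hS' : d.frobField (conjSub ρ V) (ρ * σ * ρ⁻¹) = conjSub ρ S :=
    (d.conjSub_frobField_eq V σ ρ).symm
  have hS'f : d.IsField (d.frobField (conjSub ρ V) (ρ * σ * ρ⁻¹)) := by
    rw [hS']; exact d.isField_conjSub hS ρ
  -- `ρ • π_S` is a prime of the conjugate Frobenius field
  have hπ' : ρ • d.primeOf S ∈ fixedBy A (d.frobField (conjSub ρ V) (ρ * σ * ρ⁻¹)) := by
    rw [hS']
    exact smul_mem_fixedBy_conj (d.primeOf_mem hS) ρ
  have hvπ' : d.val (d.frobField (conjSub ρ V) (ρ * σ * ρ⁻¹)) (ρ • d.primeOf S) = 1 := by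
    rw [hS', d.val_conjSub hS (d.primeOf_mem hS), d.val_primeOf hS]
  -- independence of the prime, and `norm_conj`
  have key := hcf.norm_frobField_div_mem hV' hV'U' hU'n hσ' hdσ' (d.primeOf_mem hS'f)
    (d.val_primeOf hS'f) hπ' hvπ'
  have hnorm : norm (d.frobField (conjSub ρ V) (ρ * σ * ρ⁻¹)) (conjSub ρ U) (ρ • d.primeOf S) =
      ρ • d.recElt U V σ := by
    rw [hS', norm_conj (d.primeOf_mem hS) ρ]
    rfl
  rw [hnorm] at key
  rw [QuotientGroup.eq]
  have : (d.recElt (conjSub ρ U) (conjSub ρ V) (ρ * σ * ρ⁻¹))⁻¹ * ρ • d.recElt U V σ =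
      (d.recElt (conjSub ρ U) (conjSub ρ V) (ρ * σ * ρ⁻¹) / ρ • d.recElt U V σ)⁻¹ := by
    rw [div_eq_mul_inv, mul_inv_rev, inv_inv, mul_comm]
  rw [this]
  exact inv_mem key

end WeilDatum

end AbstractCFT

end Literature.NumberTheory.GaloisRepresentations
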